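import Mathlib
import HarnessLib

/-!
# The divisible part of a `p`-primary abelian group with finite `p`-torsion: finite index, and index bounds for
# endomorphisms with finite kernel (crux ♭T≤ stmt-BirchSwinnertonDyer-23042, line `sigmacongruence`, relaxed count road, bricks (c)/(d) and R2)

Route `UniversalToricDescent`, lead prover `bsd-wall-utd-p1` g18. THEOREMS ONLY (no definition, no named fact, no `sorry`);
`--supports stmt-BirchSwinnertonDyer-23042`. Pure algebra (Mathlib only). BSD is not proved by any of this.

Let `B` be an abelian group which is `p`-primary (`∀ b, ∃ n, pⁿ b = 0`) with `B[p]` finite — on the route: `E′(K_{∞,w})[3^∞]` at a tame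
place, or a Selmer group `Sel^S(K_∞, E′[3^∞])` whose `3`-torsion is finite. Elementary structure (Fuchs §20–23; Greenberg LNM 1716 §1,
"cofinitely generated"): the subgroup `D` of divisible elements (`b ∈ D ↔ ∀ k, ∃ c, p^k c = b`) is `p`-divisible IN ITSELF and of FINITE
INDEX, `B = D + B[p^{k₀}]`. Proof without Pontryagin duality: the chain `C_k = B[p] ∩ p^k B` of subsets of the finite `B[p]` stabilises at
`k₀`; divisibility of `D` by a pigeonhole on the finite fibre `{x : p x = d}`; `B = D + B[p^{k₀}]` by induction on the exponent.

* §1 `finite_pow_torsion` — `B[p^k]` is finite for every `k`.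
* §2 `exists_divisiblePart` — **∃ `D ≤ B` with `(b ∈ D ↔ ∀ k, ∃ c, p^k • c = b)`, `D` `p`-divisible in itself, and `B ⧸ D` finite.**
* §3 consequences: `natCard_quotient_range_le_of_finite_ker` — **for an endomorphism `φ` of `B` with FINITE KERNEL, `#(B/φ(B)) ≤ #(B/D)`**
  (`φ(D) = D`: a divisible `p`-group with finite `p`-torsion has no proper subgroup of bounded finite index containing `p^a`-multiples —
  `D[p^k] = p^a D[p^{k+a}] ⊆ φ(D[p^{k+a}])`); `natCard_quotient_nsmul_range_le` — **`#(B / p^k B) ≤ #(B/D)`** for every `k`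
  (uniformly in `k`). On the route: `#(A_w/(γ_n − 1)A_w) ≤ [A_w : D_w]` uniformly in the layer `n` (kernel of the local descent map),
  and `#(Sel^S/3^k Sel^S) ≤ [Sel^S : div]` uniformly in `k` (stub R2).

References: [Fuchs1970] §20–§23; [GreenbergLNM1716] §1 (p. 54, cofinitely generated `Λ`-modules); [GreenbergVatsal2000] §2 p. 22.
-/

set_option linter.dupNamespace false
set_option autoImplicit false

namespace Summit.BirchSwinnertonDyer.BirchSwinnertonDyer.Theorems.UniversalToricDescentCofiniteDivisiblePart

variable {B : Type*} [AddCommGroup B] {p : ℕ}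

/-! ## §1 Finiteness of the `p^k`-torsion -/

/-- **`B[p^k]` is finite for every `k` when `B[p]` is** (the map `b ↦ p^k b : B[p^{k+1}] → B[p]` has fibres translates of `B[p^k]`).
[cite: Fuchs1970, §20] -/
theorem finite_pow_torsion (hfin : Set.Finite {b : B | p • b = 0}) (k : ℕ) : Set.Finite {b : B | p ^ k • b = 0} := by
  induction k with
  | zero =>
    refine (Set.finite_singleton (0 : B)).subset fun s hs ↦ ?_
    simpa using hs
  | succ k ih =>
    have hsub : {s : B | p ^ (k + 1) • s = 0} ⊆
        ⋃ t ∈ {t : B | p • t = 0}, (fun u : B × B ↦ u.1 + u.2) '' ({s : B | p ^ k • s = 0} ×ˢ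
          {s : B | p ^ (k + 1) • s = 0 ∧ p ^ k • s = t}) := by
      intro s hs
      simp only [Set.mem_setOf_eq] at hs
      refine Set.mem_biUnion (x := p ^ k • s) (by simp only [Set.mem_setOf_eq, ← mul_smul, ← pow_succ', hs]) ?_
      exact ⟨(0, s), ⟨by simp, hs, rfl⟩, by simp⟩
    refine Set.Finite.subset (Set.Finite.biUnion hfin fun t _ ↦ Set.Finite.image _ (ih.prod ?_)) hsub
    by_cases hne : {s : B | p ^ (k + 1) • s = 0 ∧ p ^ k • s = t}.Nonempty
    · obtain ⟨s₀, hs₀⟩ := hne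
      refine (ih.image fun u ↦ u + s₀).subset fun s hs ↦ ⟨s - s₀, ?_, by simp⟩
      simp only [Set.mem_setOf_eq, smul_sub, hs.2, hs₀.2, sub_self]
    · rw [Set.not_nonempty_iff_eq_empty.mp hne]
      exact Set.finite_empty

/-- Lagrange in a finite quotient: for subgroups `H ≤ G` of `B` with `G/H` finite and `x ∈ G`, `#(G/H) • x ∈ H`. [folklore] -/
theorem nsmul_natCard_mem {G : AddSubgroup B} {H : AddSubgroup B} [Finite (G ⧸ H.addSubgroupOf G)] (x : B)
    (hx : x ∈ G) : Nat.card (G ⧸ H.addSubgroupOf G) • x ∈ H := by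
  have h : Nat.card (G ⧸ H.addSubgroupOf G) • (QuotientAddGroup.mk (⟨x, hx⟩ : G) : G ⧸ H.addSubgroupOf G) = 0 :=
    card_nsmul_eq_zero'
  rw [← QuotientAddGroup.mk_nsmul, QuotientAddGroup.eq_zero_iff, AddSubgroup.mem_addSubgroupOf] at h
  simpa using h

/-! ## §2 The divisible part -/

/-- **The divisible part.** For a `p`-primary abelian group `B` with finite `B[p]`: there are a subgroup `D ≤ B` and `k₀ : ℕ`
with (i) `b ∈ D ↔ ∀ k, ∃ c, p^k • c = b` (the `p`-divisible elements), (ii) `D` is `p`-divisible in itself, (iii) every `b ∈ B` is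
`d + t` with `d ∈ D` and `p^{k₀} • t = 0`; in particular (iv) `B ⧸ D` is finite. [cite: Fuchs1970, §21 (structure of divisible and
reduced `p`-groups)] [cite: GreenbergLNM1716, §1 p. 54] -/
theorem exists_divisiblePart (hB : ∀ b : B, ∃ n : ℕ, p ^ n • b = 0) (hfin : Set.Finite {b : B | p • b = 0}) :
    ∃ (D : AddSubgroup B) (k₀ : ℕ), (∀ b : B, b ∈ D ↔ ∀ k : ℕ, ∃ c : B, p ^ k • c = b) ∧
      (∀ d ∈ D, ∃ d' ∈ D, p • d' = d) ∧ (∀ b : B, ∃ d ∈ D, p ^ k₀ • (b - d) = 0) ∧ Finite (B ⧸ D) := by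
  classical
  -- the subgroup of divisible elements
  let D : AddSubgroup B :=
    { carrier := {b | ∀ k : ℕ, ∃ c : B, p ^ k • c = b}
      zero_mem' := fun k ↦ ⟨0, smul_zero _⟩
      add_mem' := fun {a b} ha hb k ↦ by
        obtain ⟨c, hc⟩ := ha k; obtain ⟨c', hc'⟩ := hb k
        exact ⟨c + c', by rw [smul_add, hc, hc']⟩
      neg_mem' := fun {a} ha k ↦ by
        obtain ⟨c, hc⟩ := ha k
        exact ⟨-c, by rw [smul_neg, hc]⟩ }
  have hDmem : ∀ b : B, b ∈ D ↔ ∀ k : ℕ, ∃ c : B, p ^ k • c = b := fun _ ↦ Iff.rfl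
  -- the chain `C k = B[p] ∩ p^k B` stabilises
  let C : ℕ → Set B := fun k ↦ {x | p • x = 0 ∧ ∃ c : B, p ^ k • c = x}
  have hCsub : ∀ k, C k ⊆ {b : B | p • b = 0} := fun k x hx ↦ hx.1
  have hCanti : ∀ k, C (k + 1) ⊆ C k := fun k x hx ↦ by
    obtain ⟨c, hc⟩ := hx.2
    exact ⟨hx.1, ⟨p • c, by rw [← hc, pow_succ, mul_smul]⟩⟩
  have hCanti' : ∀ {k m : ℕ}, k ≤ m → C m ⊆ C k := fun {k m} hkm ↦ by
    induction hkm with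
    | refl => exact subset_rfl
    | step _ ih => exact (hCanti _).trans ih
  have hCfin : ∀ k, (C k).Finite := fun k ↦ hfin.subset (hCsub k)
  -- cardinalities form a non-increasing sequence of naturals, hence stabilise
  obtain ⟨k₀, hk₀⟩ : ∃ k₀, ∀ m, k₀ ≤ m → C m = C k₀ := by
    let f : ℕ → ℕ := fun k ↦ (hCfin k).toFinset.card
    have hfanti : ∀ k, f (k + 1) ≤ f k := fun k ↦
      Finset.card_le_card ((Set.Finite.toFinset_subset_toFinset).mpr (hCanti k))
    have hfmono : ∀ {k m : ℕ}, k ≤ m → f m ≤ f k := fun {k m} hkm ↦ by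
      induction hkm with
      | refl => exact le_rfl
      | step _ ih => exact (hfanti _).trans ih
    -- a non-increasing ℕ-sequence is eventually constant
    obtain ⟨k₀, hk₀⟩ : ∃ k₀, ∀ m, k₀ ≤ m → f m = f k₀ := by
      by_contra hcon
      push Not at hcon
      -- then `f` decreases strictly infinitely often: impossible. Build: for every `k` there is `m ≥ k` with `f m < f k`.
      have hdec : ∀ k, ∃ m, k ≤ m ∧ f m < f k := by
        intro k
        obtain ⟨m, hkm, hne⟩ := hcon k
        exact ⟨m, hkm, lt_of_le_of_ne (hfmono hkm) hne⟩
      -- iterate `f 0 + 1` times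
      have hiter : ∀ n : ℕ, ∃ m, f m + n ≤ f 0 := by
        intro n
        induction n with
        | zero => exact ⟨0, by simp⟩
        | succ n ih =>
          obtain ⟨m, hm⟩ := ih
          obtain ⟨m', -, hm'⟩ := hdec m
          exact ⟨m', by omega⟩
      obtain ⟨m, hm⟩ := hiter (f 0 + 1)
      omega
    refine ⟨k₀, fun m hm ↦ ?_⟩
    have hsub : C m ⊆ C k₀ := hCanti' hm
    have hcard : (hCfin m).toFinset.card = (hCfin k₀).toFinset.card := hk₀ m hm
    have heq : (hCfin m).toFinset = (hCfin k₀).toFinset :=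
      Finset.eq_of_subset_of_card_le ((Set.Finite.toFinset_subset_toFinset).mpr hsub) hcard.ge
    exact (Set.Finite.toFinset_inj).mp heq
  -- elements of the stable set are divisible
  have hCD : ∀ x ∈ C k₀, x ∈ D := by
    intro x hx k
    by_cases hk : k ≤ k₀
    · exact (hCanti' hk hx).2
    · have h := hx
      rw [← hk₀ k (not_le.mp hk).le] at h
      exact h.2
  -- `D` is `p`-divisible in itself (pigeonhole on the finite fibre `{x | p • x = d}`)
  have hDdiv : ∀ d ∈ D, ∃ d' ∈ D, p • d' = d := by
    intro d hd
    -- for each `k`, an element `e k` with `p • e k = d` and `e k ∈ p^k B`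
    have he : ∀ k : ℕ, ∃ e : B, p • e = d ∧ ∃ c : B, p ^ k • c = e := by
      intro k
      obtain ⟨c, hc⟩ := (hDmem d).mp hd (k + 1)
      exact ⟨p ^ k • c, by rw [← mul_smul, ← pow_succ', hc], c, rfl⟩
    choose e hed hec using he
    -- the fibre is finite: a translate of `B[p]`
    have hfib : Set.Finite {x : B | p • x = d} := by
      refine (hfin.image fun u ↦ u + e 0).subset fun x hx ↦ ⟨x - e 0, ?_, by simp⟩
      simp only [Set.mem_setOf_eq] at hx ⊢
      rw [smul_sub, hx, hed 0, sub_self]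
    -- pigeonhole: some fibre element is `e k` for infinitely many `k`
    haveI : Finite {x : B | p • x = d} := hfib.to_subtype
    let g : ℕ → {x : B | p • x = d} := fun k ↦ ⟨e k, hed k⟩
    obtain ⟨⟨x, hx⟩, hinf⟩ := Finite.exists_infinite_fiber g
    refine ⟨x, (hDmem x).mpr fun k ↦ ?_, hx⟩
    -- some `m ≥ k` with `e m = x`; then `x ∈ p^m B ⊆ p^k B`
    have hinf' : Set.Infinite (g ⁻¹' {⟨x, hx⟩}) := Set.infinite_coe_iff.mp hinf
    obtain ⟨m, hm, hkm⟩ := hinf'.exists_gt k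
    have hmx : e m = x := by
      have h1 : g m = ⟨x, hx⟩ := hm
      exact congrArg Subtype.val h1
    obtain ⟨c, hc⟩ := hec m
    refine ⟨p ^ (m - k) • c, ?_⟩
    rw [← mul_smul, ← pow_add, Nat.add_sub_cancel' hkm.le, hc, hmx]
  -- `B = D + B[p^{k₀}]`: induction on the exponent
  have hdecomp : ∀ (j : ℕ) (b : B), p ^ j • b = 0 → ∃ d ∈ D, p ^ k₀ • (b - d) = 0 := by
    intro j
    induction j with
    | zero =>
      intro b hb
      rw [pow_zero, one_smul] at hb
      exact ⟨0, D.zero_mem, by rw [hb, sub_zero, smul_zero]⟩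
    | succ j ih =>
      intro b hb
      by_cases hj : j + 1 ≤ k₀
      · refine ⟨0, D.zero_mem, ?_⟩
        rw [sub_zero, ← Nat.sub_add_cancel hj, pow_add, mul_smul, hb, smul_zero]
      · -- `x = p^j b ∈ B[p] ∩ p^j B = C j = C k₀ ⊆ D`
        have hjk : k₀ ≤ j := by omega
        have hxC : p ^ j • b ∈ C j := ⟨by rw [← mul_smul, ← pow_succ', hb], b, rfl⟩
        rw [hk₀ j hjk] at hxC
        have hxD : p ^ j • b ∈ D := hCD _ hxC
        -- divide `p^j • b` by `p^j` inside `D`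
        have hdivpow : ∀ (i : ℕ) (y : B), y ∈ D → ∃ d ∈ D, p ^ i • d = y := by
          intro i
          induction i with
          | zero => exact fun y hy ↦ ⟨y, hy, by rw [pow_zero, one_smul]⟩
          | succ i ih' =>
            intro y hy
            obtain ⟨y', hy', hy'eq⟩ := hDdiv y hy
            obtain ⟨d, hd, hdeq⟩ := ih' y' hy'
            exact ⟨d, hd, by rw [pow_succ', mul_smul, hdeq, hy'eq]⟩
        obtain ⟨d, hd, hdeq⟩ := hdivpow j _ hxD
        -- `b - d` has exponent `≤ j`
        have hbd : p ^ j • (b - d) = 0 := by rw [smul_sub, hdeq, sub_self]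
        obtain ⟨d', hd', hd'eq⟩ := ih (b - d) hbd
        refine ⟨d + d', D.add_mem hd hd', ?_⟩
        rwa [← sub_sub]
  have hdecomp' : ∀ b : B, ∃ d ∈ D, p ^ k₀ • (b - d) = 0 := fun b ↦ by
    obtain ⟨n, hn⟩ := hB b
    exact hdecomp n b hn
  -- finiteness of `B ⧸ D`: image of the finite `B[p^{k₀}]`
  have hfink₀ : Set.Finite {b : B | p ^ k₀ • b = 0} := finite_pow_torsion hfin k₀
  haveI : Finite {b : B | p ^ k₀ • b = 0} := hfink₀.to_subtype
  have hsurj : Function.Surjective (fun t : {b : B | p ^ k₀ • b = 0} ↦ (QuotientAddGroup.mk (t : B) : B ⧸ D)) := by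
    intro q
    obtain ⟨b, rfl⟩ := QuotientAddGroup.mk_surjective q
    obtain ⟨d, hd, hbd⟩ := hdecomp' b
    refine ⟨⟨b - d, hbd⟩, ?_⟩
    rw [QuotientAddGroup.eq_iff_sub_mem]
    simp only [sub_sub_cancel_left, neg_mem_iff]
    exact hd
  exact ⟨D, k₀, hDmem, hDdiv, hdecomp', Finite.of_surjective _ hsurj⟩

/-! ## §3 Index bounds -/

/-- Powers: a `p`-divisible subgroup is `p^i`-divisible. [folklore] -/
theorem exists_pow_nsmul_eq_of_divisible {D : AddSubgroup B} (hDdiv : ∀ d ∈ D, ∃ d' ∈ D, p • d' = d) (i : ℕ)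
    (y : B) (hy : y ∈ D) : ∃ d ∈ D, p ^ i • d = y := by
  induction i generalizing y with
  | zero => exact ⟨y, hy, by rw [pow_zero, one_smul]⟩
  | succ i ih =>
    obtain ⟨y', hy', hy'eq⟩ := hDdiv y hy
    obtain ⟨d, hd, hdeq⟩ := ih y' hy'
    exact ⟨d, hd, by rw [pow_succ', mul_smul, hdeq, hy'eq]⟩

/-- **An endomorphism with finite kernel is ONTO the divisible part**: if `φ : B →+ B` has finite kernel and `D` is the subgroup of
divisible elements (so `φ(D) ≤ D`), `p`-primary with `D[p]` finite, then `D ≤ φ(D)`. Proof: for `d ∈ D[p^k]`, with `p^a ≥ #ker φ`: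
`d = p^a d₁` with `d₁ ∈ D ∩ B[p^{k+a}]`; on the finite group `G = D ∩ B[p^{k+a}]`, `φ(G) ≤ G` has index `≤ #ker φ ≤ p^a`… we use
instead the exponent form: `#(G/φ(G)) • G ≤ φ(G)` and `#(G/φ(G)) ∣ #G` is a power of `p` bounded by `#ker φ`, so `p^a G ≤ φ(G)`.
[cite: Fuchs1970, §20 (divisible groups are injective; here an elementary count)] -/
theorem le_map_of_finite_ker (hp : p.Prime) (hB : ∀ b : B, ∃ n : ℕ, p ^ n • b = 0) (hfin : Set.Finite {b : B | p • b = 0})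
    {D : AddSubgroup B} (hDmem : ∀ b : B, b ∈ D ↔ ∀ k : ℕ, ∃ c : B, p ^ k • c = b)
    (hDdiv : ∀ d ∈ D, ∃ d' ∈ D, p • d' = d) (φ : B →+ B) (hker : Set.Finite (φ.ker : Set B)) :
    D ≤ D.map φ := by
  classical
  -- `φ(D) ≤ D`
  have hφD : ∀ d ∈ D, φ d ∈ D := fun d hd ↦ (hDmem _).mpr fun k ↦ by
    obtain ⟨c, hc⟩ := (hDmem d).mp hd k
    exact ⟨φ c, by rw [← map_nsmul, hc]⟩
  -- the kernel has order `≤ p^a` for `a = #ker φ` (crude: `n ≤ p^n`)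
  haveI hkerfin : Finite φ.ker := hker.to_subtype
  set a := Nat.card φ.ker with ha
  intro d hd
  obtain ⟨k, hk⟩ := hB d
  -- the finite group `G = D ∩ B[p^{k+a}]`
  let G : AddSubgroup B :=
    { carrier := {x | x ∈ D ∧ p ^ (k + a) • x = 0}
      zero_mem' := ⟨D.zero_mem, smul_zero _⟩
      add_mem' := fun {x y} hx hy ↦ ⟨D.add_mem hx.1 hy.1, by rw [smul_add, hx.2, hy.2, add_zero]⟩
      neg_mem' := fun {x} hx ↦ ⟨D.neg_mem hx.1, by rw [smul_neg, hx.2, neg_zero]⟩ }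
  have hGmem : ∀ x, x ∈ G ↔ x ∈ D ∧ p ^ (k + a) • x = 0 := fun _ ↦ Iff.rfl
  haveI hGfin : Finite G := by
    have h := (finite_pow_torsion hfin (k + a)).subset (fun x (hx : x ∈ (G : Set B)) ↦ ((hGmem x).mp hx).2)
    exact h.to_subtype
  -- `φ(G) ≤ G`
  have hφG : G.map φ ≤ G := by
    rintro _ ⟨x, hx, rfl⟩
    exact ⟨hφD x ((hGmem x).mp hx).1, by rw [← map_nsmul, ((hGmem x).mp hx).2, map_zero]⟩
  -- index of `φ(G)` in `G` is at most `#ker φ = a`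
  haveI : Finite (G ⧸ (G.map φ).addSubgroupOf G) := inferInstance
  have hidx : Nat.card (G ⧸ (G.map φ).addSubgroupOf G) ≤ a := by
    -- `#G = [G : φG] · #φG` and `#G ≤ #ker φ · #φG`
    have hlag : Nat.card G = Nat.card (G ⧸ (G.map φ).addSubgroupOf G) * Nat.card (G.map φ) := by
      rw [AddSubgroup.card_eq_card_quotient_mul_card_addSubgroup ((G.map φ).addSubgroupOf G),
        Nat.card_congr (AddSubgroup.addSubgroupOfEquivOfLe hφG).toEquiv]
    -- `φ|_G : G → φ(G)` has fibres of size ≤ #ker φ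
    haveI : Finite (G.map φ) := Finite.of_injective (fun y : G.map φ ↦ (⟨y, hφG y.2⟩ : G)) fun x y h ↦
      Subtype.ext (congrArg (fun z : G ↦ (z : B)) h)
    let ψ : G → G.map φ := fun x ↦ ⟨φ x, ⟨x, x.2, rfl⟩⟩
    have hψsurj : Function.Surjective ψ := by
      rintro ⟨_, x, hx, rfl⟩; exact ⟨⟨x, hx⟩, rfl⟩
    have hcardG : Nat.card G ≤ a * Nat.card (G.map φ) := by
      -- `G` injects into `ker φ × φ(G)` after choosing a section? Simpler: count fibres.
      rw [← Nat.card_prod]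
      obtain ⟨s, hs⟩ := hψsurj.hasRightInverse
      refine Nat.card_le_card_of_injective (fun x : G ↦ (⟨(x : B) - (s (ψ x) : B), ?_⟩, ψ x)) ?_
      · rw [AddMonoidHom.mem_ker, map_sub, sub_eq_zero]
        have h1 : ψ (s (ψ x)) = ψ x := hs (ψ x)
        have h2 := congrArg (fun z : G.map φ ↦ (z : B)) h1
        exact h2.symm
      · intro x y hxy
        simp only [Prod.mk.injEq, Subtype.mk.injEq] at hxy
        obtain ⟨h1, h2⟩ := hxy
        rw [h2] at h1
        exact Subtype.ext (sub_left_injective h1)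
    have hpos : 0 < Nat.card (G.map φ) := Nat.card_pos
    rw [hlag] at hcardG
    exact Nat.le_of_mul_le_mul_right hcardG hpos
  -- hence `a! `-free form: `N • G ≤ φ(G)` with `N = [G : φG] ≤ a`, and `N ∣ #G` a power of `p`? We avoid: use `N • x ∈ φ(G)` and
  -- write `d = p^a • d₁`, and `N ∣ p^a`? Not needed: `d = N • (M • d₂)` where we divide `d` by `N` inside `D` using primality:
  -- every `N` with `0 < N` acts invertibly modulo... Simplest: `N ≤ a ≤ p^a`, and `D` is `p^a`-divisible; but we need EXACT division by `N`.
  -- Instead: `N` divides `#G`, and `#G` is a power of `p` (a finite `p`-primary group), so `N = p^j` with `p^j ≤ a`, `j ≤ a`.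
  set N := Nat.card (G ⧸ (G.map φ).addSubgroupOf G) with hN
  have hNpos : 0 < N := Nat.card_pos
  -- `#G` is a power of `p`
  have hGpow : ∃ m, Nat.card G = p ^ m := by
    haveI : Fact p.Prime := ⟨hp⟩
    -- `IsPGroup` for `Multiplicative G`
    have hpg : IsPGroup p (Multiplicative G) := by
      intro g
      obtain ⟨n, hn⟩ := hB ((Multiplicative.toAdd g : G) : B)
      refine ⟨n, ?_⟩
      apply Multiplicative.toAdd.injective
      apply Subtype.ext
      rw [toAdd_pow, toAdd_one]
      simp only [AddSubgroupClass.coe_nsmul, ZeroMemClass.coe_zero]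
      exact hn
    obtain ⟨m, hm⟩ := hpg.exists_card_eq
    exact ⟨m, by rw [← hm, Nat.card_congr Multiplicative.toAdd]⟩
  have hNdvd : N ∣ Nat.card G := by
    rw [hN]
    exact AddSubgroup.card_quotient_dvd_card _
  obtain ⟨m, hm⟩ := hGpow
  rw [hm] at hNdvd
  obtain ⟨j, hj, hNeq⟩ := (Nat.dvd_prime_pow hp).mp hNdvd
  -- divide `d` by `p^j` inside `D`: `d = p^j • d₁`, and `d₁ ∈ G` since `p^(k+a) • d₁ = p^(k + a - j) • d = 0` (`j ≤ a`)
  have hja : j ≤ a := by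
    have h1 : p ^ j ≤ a := by rw [← hNeq]; exact hidx
    exact (Nat.lt_pow_self hp.one_lt).le.trans h1
  obtain ⟨d₁, hd₁D, hd₁⟩ := exists_pow_nsmul_eq_of_divisible hDdiv j d hd
  have hd₁G : d₁ ∈ G := by
    refine ⟨hd₁D, ?_⟩
    rw [show k + a = (a - j) + k + j from by omega, pow_add, mul_smul, hd₁, pow_add, mul_smul, hk, smul_zero]
  -- `N • d₁ ∈ φ(G)`, i.e. `d = p^j • d₁ ∈ φ(G) ≤ φ(D)`
  have hmem := nsmul_natCard_mem (H := G.map φ) d₁ hd₁G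
  rw [← hN, hNeq, hd₁] at hmem
  exact AddSubgroup.map_mono (fun x hx ↦ ((hGmem x).mp hx).1) hmem

/-- **`#(B/φ(B)) ≤ #(B/D)` for an endomorphism `φ` with finite kernel** (`D` the divisible part): `φ(B) ⊇ φ(D) ⊇ D`.
[cite: GreenbergLNM1716, §1 p. 54] -/
theorem natCard_quotient_range_le_of_finite_ker (hp : p.Prime) (hB : ∀ b : B, ∃ n : ℕ, p ^ n • b = 0)
    (hfin : Set.Finite {b : B | p • b = 0})
    {D : AddSubgroup B} (hDmem : ∀ b : B, b ∈ D ↔ ∀ k : ℕ, ∃ c : B, p ^ k • c = b)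
    (hDdiv : ∀ d ∈ D, ∃ d' ∈ D, p • d' = d) [Finite (B ⧸ D)] (φ : B →+ B) (hker : Set.Finite (φ.ker : Set B)) :
    Finite (B ⧸ φ.range) ∧ Nat.card (B ⧸ φ.range) ≤ Nat.card (B ⧸ D) := by
  have hle : D ≤ φ.range := fun d hd ↦ by
    obtain ⟨x, -, hx⟩ := le_map_of_finite_ker hp hB hfin hDmem hDdiv φ hker hd
    exact ⟨x, hx⟩
  have hsurj : Function.Surjective (QuotientAddGroup.map D φ.range (AddMonoidHom.id B) hle) := by
    intro q
    obtain ⟨b, rfl⟩ := QuotientAddGroup.mk_surjective q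
    exact ⟨QuotientAddGroup.mk b, rfl⟩
  exact ⟨Finite.of_surjective _ hsurj, Nat.card_le_card_of_surjective _ hsurj⟩

/-- **`#(B / p^k B) ≤ #(B/D)` for every `k`** (the multiplication `p^k` has finite kernel `B[p^k]`), uniformly in `k`.
[cite: GreenbergLNM1716, §1 p. 54] -/
theorem natCard_quotient_nsmul_range_le (hp : p.Prime) (hB : ∀ b : B, ∃ n : ℕ, p ^ n • b = 0)
    (hfin : Set.Finite {b : B | p • b = 0})
    {D : AddSubgroup B} (hDmem : ∀ b : B, b ∈ D ↔ ∀ k : ℕ, ∃ c : B, p ^ k • c = b)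
    (hDdiv : ∀ d ∈ D, ∃ d' ∈ D, p • d' = d) [Finite (B ⧸ D)] (k : ℕ) :
    Finite (B ⧸ (nsmulAddMonoidHom (α := B) (p ^ k)).range) ∧
      Nat.card (B ⧸ (nsmulAddMonoidHom (α := B) (p ^ k)).range) ≤ Nat.card (B ⧸ D) := by
  refine natCard_quotient_range_le_of_finite_ker hp hB hfin hDmem hDdiv _ ?_
  refine (finite_pow_torsion hfin k).subset fun b hb ↦ ?_
  simpa [AddMonoidHom.mem_ker] using hb

end Summit.BirchSwinnertonDyer.BirchSwinnertonDyer.Theorems.UniversalToricDescentCofiniteDivisiblePart
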